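import Summits.RiemannHypothesis.RiemannHypothesis.Theorems.TiltedLandingLaw421R3SuccTheft
import Summits.RiemannHypothesis.RiemannHypothesis.Theorems.TiltedLandingLaw421R3Dimple

/-! # TiltedLandingLaw421 — round 3q SUPPORT, part 2: ESCAPE LEDGER, FAR DROP, NEAR-MISS TOOL, MULTI-SCALE DIMPLE (W-08, C1 rh-idea-5 g26)

SUPPORT module (no stub, no crux, no `sorry`). GLOBAL forms only. Nothing here bears on the truth of RH; RH is not proved.

Continuation of the tree's `…R3SuccTheft` (= §1–§4 of C1 g26's AntiTheft file: exact nesting, `AntiTheft`, `restSuccBotQ_of_theft(G)`), same namespace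
`RhW08.SuccTheft`; this part carries §5–§9 of the LANDING IMAGE 10271b71 with §1–§4 removed (they are in the tree):

* §5 ★ the ESCAPE LEDGER `nonrealCount_deriv_eq_of_localB(_core)`, `escapeLedger_levelj` — in a sign window whose base carries no NL event, `f^{(j+1)}` has
  EXACTLY as many non-real zeros in the open box as `f^{(j)}` (Kim 1996 Thm 1 / Ki–Kim (3.1) with `fourK = 0`).
* §6 (RATE, (R2)) ★ the FAR-LEVEL DROP `farDrop_levelj` and its exact algebra (`pairField`, `extField`, `pairField_eq_neg_extField`, `norm_pairField_mul`,
  `energyDrop_real(_sharp)`, `energyDrop_of_pairField_le`).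
* §7 (RATE) the far-field input typed as a socket `FarFieldBoundQ` (OPEN) and `farDrop_of_farFieldBoundQ`.
* §8 the NEAR-MISS (K) TOOL: `NearMissAt`, `SlackAt`, ★ `stTrkDQ_succ_of_nearMiss`, `slackAt_of_column`, `slackAt_of_wing` (the global near-miss/slack SOCKETS
  of v5 are STRUCK — critic RESULT-19 — and not here).
* §9 ★ MULTI-SCALE DIMPLE / strong-field alternative: `readyR2_of_dimple_scale`, `blocked_at_scale`.

Typed ≠ proved for the sockets; RH is not proved; 24774 OPEN. -/

namespace RhW08.SuccTheft

open Complex Set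
open scoped ComplexConjugate
open Literature.Analysis.Complex
open RhIdea6.G17.W07C7 RhIdea6.G17.W07C7.Rev6 RhIdea6.G18.W07C8.Law421BirthS RhIdea6.G19.W07C11.Seam
open RhIdea6.G20.W07C12.Frac RhIdea6.G20.W07C12.StColP RhW07.C12.FieldSplit RhIdea6.G21.W07C13.TentMax
open RhW07.C14.TwoSided RhW07.C14.Classes RhW07.C14.Lineage RhW07.C14.Booking
open RhW07.C13.Heredity RhIdea6.G22.W07C15pre.Injection RhW07.E3.Cell RhW07.E3.Lit
open RhW08.Round1 RhW08.StSwap RhW08.Round2 RhW08.QuadW RhW08.SealSwapQ RhW08.SealSwap RhW08.SuccB RhW08.SuccSplit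
open Summit.RiemannHypothesis.RiemannHypothesis.Theorems.Splittings.JensenWindow

/-! ## §5 The ESCAPE LEDGER: count conservation in a sign window with no critical (non-Laguerre) real point -/

/-- (Core form.) In a sign window `[α,β] × [−h,h]` of a real entire `f` (any boundary predicate `P` forcing `Im w · Im (f′/f)(w) < 0`), the local
Laguerre law B on `(α,β)` (no NL event) forces CONSERVATION of the non-real zero count: `f′` has exactly as many non-real zeros in the open box as `f`
(with multiplicity). (Kim 1996 Thm 1 / Ki–Kim (3.1) with `fourK = 0`.) [cite: Kim1996, Thm 1 p. 821; KiKim2000, (3.1)] -/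
theorem nonrealCount_deriv_eq_of_localB_core {f : ℂ → ℂ} (hfd : Differentiable ℂ f) (hreal : ∀ x : ℝ, (f x).im = 0)
    {P : ℂ → Prop} (hsgn : ∀ {w : ℂ}, w.im ≠ 0 → P w → w.im * (deriv f w / f w).im < 0)
    {α β h : ℝ} (hW : SWindow f P α β h) (hB : LocalB f α β) :
    zeroCountC (deriv f) (Ioo α β ×ℂ Ioo (-h) h) - zeroCountC (deriv f) ((Ioo α β ×ℂ Ioo (-h) h) ∩ {ρ | ρ.im = 0}) =
      zeroCountC f (Ioo α β ×ℂ Ioo (-h) h) - zeroCountC f ((Ioo α β ×ℂ Ioo (-h) h) ∩ {ρ | ρ.im = 0}) := by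
  set F : ℝ → ℝ := fun t ↦ (f t).re with hFdef
  have h1d := differentiable_deriv hfd
  have hFan : ∀ x, AnalyticAt ℝ F x := KiKim.analyticAt_re_ofReal hfd
  have hdF : deriv F = fun t : ℝ ↦ (deriv f t).re :=
    funext fun t ↦ (KiKim.hasDerivAt_re_ofReal (hfd.differentiableAt)).deriv
  have hddF : deriv (deriv F) = fun t : ℝ ↦ (deriv (deriv f) t).re := by
    rw [hdF]; exact funext fun t ↦ (KiKim.hasDerivAt_re_ofReal (h1d.differentiableAt)).deriv
  have dreal : ∀ t : ℝ, (deriv f t).im = 0 := im_deriv_ofReal hfd hreal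
  have reF : ∀ {t : ℝ}, f t ≠ 0 → F t ≠ 0 := fun {t} ht h0 ↦
    ht (Complex.ext (by simpa [F] using h0) (by simp [hreal t]))
  have reF' : ∀ {t : ℝ}, deriv f t ≠ 0 → (deriv f t).re ≠ 0 := fun {t} ht h0 ↦
    ht (Complex.ext (by simpa using h0) (by simp [dreal t]))
  have hF'ne : deriv F ≠ 0 := by
    intro h0
    have := congrFun h0 α
    rw [hdF] at this
    exact reF' hW.dα (by simpa using this)
  have hFα' : deriv F α ≠ 0 := by rw [hdF]; exact reF' hW.dα
  have hFβ' : deriv F β ≠ 0 := by rw [hdF]; exact reF' hW.dβ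
  obtain ⟨-, -, hiff⟩ :=
    KiKim.fourK_nonneg_dvd_iff hFan hF'ne hW.lt (reF hW.fα) hFα' (reF hW.fβ) hFβ'
  have h4 : KiKim.fourK F α β = 0 := by
    refine hiff.mpr fun c hc hdc hFc ↦ ?_
    have hdc' : deriv f c = 0 := by
      rw [hdF] at hdc
      exact Complex.ext (by simpa using hdc) (by simp [dreal c])
    have hfc : f c ≠ 0 := fun h0 ↦ hFc (by simp [F, h0])
    have hb := hB c hc hdc' hfc
    have e : (f c * deriv (deriv f) c).re = F c * deriv (deriv F) c := by
      rw [Complex.mul_re, hreal c, hddF]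
      simp [F]
    rwa [e] at hb
  have hc := local_deGua_count_core hfd hreal hsgn hW
  rw [h4] at hc
  push_cast at hc
  linear_combination (-1 / 2 : ℂ) * hc

/-- Window form (Jensen-clear boundary): in a Jensen window with local B, `f′` has exactly as many non-real zeros in the open box as `f`. -/
theorem nonrealCount_deriv_eq_of_localB {f : ℂ → ℂ} (hf : RealEntireLt2 f) {α β h : ℝ} (hW : Window f α β h)
    (hex : ∃ a, f a = 0) (hB : LocalB f α β) :
    zeroCountC (deriv f) (Ioo α β ×ℂ Ioo (-h) h) - zeroCountC (deriv f) ((Ioo α β ×ℂ Ioo (-h) h) ∩ {ρ | ρ.im = 0}) =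
      zeroCountC f (Ioo α β ×ℂ Ioo (-h) h) - zeroCountC f ((Ioo α β ×ℂ Ioo (-h) h) ∩ {ρ | ρ.im = 0}) := by
  obtain ⟨ρ, C, hρ0, hρ, hgr⟩ := hf.growth
  exact nonrealCount_deriv_eq_of_localB_core hf.diff hf.real
    (fun hw hc ↦ Summit.RiemannHypothesis.RiemannHypothesis.Theorems.Splittings.JensenWindow.im_mul_im_logDeriv_neg hf.diff hρ0 hρ hgr hf.real hex hw hc) hW.toSWindow hB

/-- ★ THE ESCAPE LEDGER at level `j` (tree form): for a legal frame, a sign window of `f^{(j)}` (boundary predicate `P` with the sign property) whose base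
`(α, β)` carries NO NL event of level `j` — in particular any window with base inside the level-`j` range at a level that is not Tilt-ready — the
non-real zeros of `f^{(j+1)}` in the open box are exactly as many as those of `f^{(j)}` (with multiplicity). Under «no successor» every one of them is an
ESCAPEE (out of band) — and, by `AllStolen`, inside an out-of-band thief's disc. -/
theorem escapeLedger_levelj {η : ℝ} {f : ℂ → ℂ} {x₀ s hmax R Hs : ℝ} {B : ℕ} (hE : EngineHyps5 2 η f x₀ s hmax R Hs B) (j : ℕ)
    {P : ℂ → Prop} (hsgn : ∀ {w : ℂ}, w.im ≠ 0 → P w → w.im * (deriv (iteratedDeriv j f) w / iteratedDeriv j f w).im < 0)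
    {α β h : ℝ} (hW : SWindow (iteratedDeriv j f) P α β h) (hnoNL : ∀ c ∈ Ioo α β, ¬ NLEventOf f j c) :
    zeroCountC (iteratedDeriv (j + 1) f) (Ioo α β ×ℂ Ioo (-h) h) - zeroCountC (iteratedDeriv (j + 1) f) ((Ioo α β ×ℂ Ioo (-h) h) ∩ {ρ | ρ.im = 0}) =
      zeroCountC (iteratedDeriv j f) (Ioo α β ×ℂ Ioo (-h) h) - zeroCountC (iteratedDeriv j f) ((Ioo α β ×ℂ Ioo (-h) h) ∩ {ρ | ρ.im = 0}) := by
  have hf : RealEntireLt2 f := by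
    refine { diff := hE.1, real := hE.2.1, growth := ?_ }
    obtain ⟨A', B', ρ, hρ, hgr⟩ := hE.2.2.1
    obtain ⟨τ, C', hτ0, hτ2, _, hgr'⟩ := StubAnalyticHeredity.growth_treeForm hE.1 ⟨A', B', ρ, hρ, hgr⟩
    exact ⟨τ, C', hτ0, hτ2, hgr'⟩
  have hB : LocalB (iteratedDeriv j f) α β := by
    by_contra hB
    obtain ⟨c, hc, hNL⟩ := nlEventOf_of_not_localB hf j hB
    exact hnoNL c hc hNL
  have e1 : deriv (iteratedDeriv j f) = iteratedDeriv (j + 1) f := by rw [← iteratedDeriv_succ]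
  have h := nonrealCount_deriv_eq_of_localB_core (differentiable_iteratedDeriv_of_entire hE.1 j) (im_iteratedDeriv_ofReal hE.1 hE.2.1 j) hsgn hW hB
  rw [e1] at h
  exact h

/-! ## §6 (RATE side, (R2)) The FAR-LEVEL ENERGY DROP: exact algebra of the frozen-field identity `P_v(w) = −K_v(w)` -/

/-- ★ (R2-algebra, sharp division-free form) `X = (Re w − Re v)²`, `y = Im w > 0`, `b = Im v > 0`; the successor is NESTED (`X + y² ≤ b²`) and the
pair field at `w` is bounded by `κ`: `|P_v(w)|² = 4(X + y²)/((X + (y−b)²)(X + (y+b)²)) ≤ κ²`. Then `2(X + y²)(b + y) ≤ κ² b (b² − y²)(X + (y+b)²)`;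
in the HOVER limit `X → 0, y → b` this reads `b² − y² ≥ 1/κ²` — exactly the far law's `(s/η)²`. -/
theorem energyDrop_real_sharp {X y b κ : ℝ} (hX : 0 ≤ X) (hb : 0 < b) (hy : 0 < y)
    (hnest : X + y ^ 2 ≤ b ^ 2) (hfield : 4 * (X + y ^ 2) ≤ κ ^ 2 * ((X + (y - b) ^ 2) * (X + (y + b) ^ 2))) :
    2 * (X + y ^ 2) * (b + y) ≤ κ ^ 2 * b * (b ^ 2 - y ^ 2) * (X + (y + b) ^ 2) := by
  have h1 : X + (y - b) ^ 2 ≤ 2 * b * (b - y) := by nlinarith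
  have h2' : 0 ≤ X + (y + b) ^ 2 := by positivity
  have hκ2 : 0 ≤ κ ^ 2 := sq_nonneg κ
  have h3 : κ ^ 2 * ((X + (y - b) ^ 2) * (X + (y + b) ^ 2)) ≤ κ ^ 2 * (2 * b * (b - y) * (X + (y + b) ^ 2)) :=
    mul_le_mul_of_nonneg_left (mul_le_mul_of_nonneg_right h1 h2') hκ2
  nlinarith [hfield.trans h3]

/-- (R2-algebra, `y`-only form) under the same hypotheses `2y² ≤ κ² b (b + y)(b² − y²)`: the Jensen energy `Im²` drops across the step by at least
`2y²/(κ² b (b + y))` (`= 1/κ²` at hover `y = b`; `≥ (1 − s/(4b))²/κ²` when `y ≥ b − s/4`). -/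
theorem energyDrop_real {X y b κ : ℝ} (hX : 0 ≤ X) (hb : 0 < b) (hy : 0 < y)
    (hnest : X + y ^ 2 ≤ b ^ 2) (hfield : 4 * (X + y ^ 2) ≤ κ ^ 2 * ((X + (y - b) ^ 2) * (X + (y + b) ^ 2))) :
    2 * y ^ 2 ≤ κ ^ 2 * b * (b + y) * (b ^ 2 - y ^ 2) := by
  have h := energyDrop_real_sharp hX hb hy hnest hfield
  have hyb : y ≤ b := by nlinarith
  have hκ2 : 0 ≤ κ ^ 2 := sq_nonneg κ
  -- `(X + y²)(y+b)² ≥ y²(X + (y+b)²)` since `(y+b)² ≥ y²`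
  have hmono : y ^ 2 * (X + (y + b) ^ 2) ≤ (X + y ^ 2) * (y + b) ^ 2 := by
    have e : (X + y ^ 2) * (y + b) ^ 2 - y ^ 2 * (X + (y + b) ^ 2) = X * (b * (2 * y + b)) := by ring
    have : 0 ≤ X * (b * (2 * y + b)) := by positivity
    linarith
  -- multiply `h` by `(y+b)²/(X+(y+b)²)`-free manipulation:
  -- 2 y² (b+y) (X + (y+b)²) ≤ 2 (X+y²)(b+y)(y+b)² ≤ κ² b (b²−y²)(X+(y+b)²)(y+b)²
  have h4 : 2 * y ^ 2 * (b + y) * (X + (y + b) ^ 2) ≤ κ ^ 2 * b * (b ^ 2 - y ^ 2) * (X + (y + b) ^ 2) * (y + b) ^ 2 := by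
    have hby : 0 ≤ b + y := by linarith
    calc 2 * y ^ 2 * (b + y) * (X + (y + b) ^ 2) = 2 * (b + y) * (y ^ 2 * (X + (y + b) ^ 2)) := by ring
      _ ≤ 2 * (b + y) * ((X + y ^ 2) * (y + b) ^ 2) := mul_le_mul_of_nonneg_left hmono (by positivity)
      _ = (2 * (X + y ^ 2) * (b + y)) * (y + b) ^ 2 := by ring
      _ ≤ (κ ^ 2 * b * (b ^ 2 - y ^ 2) * (X + (y + b) ^ 2)) * (y + b) ^ 2 := mul_le_mul_of_nonneg_right h (sq_nonneg _)
      _ = _ := by ring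
  have hpos : 0 < (b + y) * (X + (y + b) ^ 2) := by positivity
  have h5 : (2 * y ^ 2) * ((b + y) * (X + (y + b) ^ 2)) ≤ (κ ^ 2 * b * (b + y) * (b ^ 2 - y ^ 2)) * ((b + y) * (X + (y + b) ^ 2)) := by
    have e1 : 2 * y ^ 2 * (b + y) * (X + (y + b) ^ 2) = (2 * y ^ 2) * ((b + y) * (X + (y + b) ^ 2)) := by ring
    have e2 : κ ^ 2 * b * (b ^ 2 - y ^ 2) * (X + (y + b) ^ 2) * (y + b) ^ 2 =
        (κ ^ 2 * b * (b + y) * (b ^ 2 - y ^ 2)) * ((b + y) * (X + (y + b) ^ 2)) := by ring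
    rw [← e1, ← e2]; exact h4
  exact le_of_mul_le_mul_right h5 hpos

/-- The PAIR FIELD of the zero pair `v, v̄` (multiplicity one) at `w`: `P_v(w) = 1/(w − v) + 1/(w − v̄)`. -/
noncomputable def pairField (v w : ℂ) : ℂ := (w - v)⁻¹ + (w - conj v)⁻¹

/-- The EXTERNAL FIELD at level `j` relative to the pair `v`: `K_v(w) = f^{(j+1)}(w)/f^{(j)}(w) − P_v(w)` (all other zeros + the linear term). -/
noncomputable def extField (f : ℂ → ℂ) (j : ℕ) (v w : ℂ) : ℂ := iteratedDeriv (j + 1) f w / iteratedDeriv j f w - pairField v w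

/-- FROZEN-FIELD IDENTITY: at a zero `w` of `f^{(j+1)}`, `P_v(w) = −K_v(w)` exactly. -/
theorem pairField_eq_neg_extField {f : ℂ → ℂ} {j : ℕ} {v w : ℂ} (hw0 : iteratedDeriv (j + 1) f w = 0) :
    pairField v w = -extField f j v w := by
  simp [extField, hw0]

/-- `‖w − v‖²` in coordinates. -/
theorem norm_sub_sq' (w v : ℂ) : ‖w - v‖ ^ 2 = (w.re - v.re) ^ 2 + (w.im - v.im) ^ 2 := by
  rw [← Complex.normSq_eq_norm_sq, Complex.normSq_apply]; simp; ring

/-- `‖w − conj v‖²` in coordinates. -/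
theorem norm_sub_conj_sq' (w v : ℂ) : ‖w - conj v‖ ^ 2 = (w.re - v.re) ^ 2 + (w.im + v.im) ^ 2 := by
  rw [← Complex.normSq_eq_norm_sq, Complex.normSq_apply]; simp; ring

/-- `‖w − Re v‖²` in coordinates. -/
theorem norm_sub_re_sq' (w v : ℂ) : ‖w - (v.re : ℂ)‖ ^ 2 = (w.re - v.re) ^ 2 + w.im ^ 2 := by
  rw [← Complex.normSq_eq_norm_sq, Complex.normSq_apply]; simp; ring

/-- The pair field in closed form: `‖P_v(w)‖·‖w − v‖·‖w − v̄‖ = 2‖w − Re v‖` (`P_v(w) = 2(w − Re v)/((w − v)(w − v̄))`). -/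
theorem norm_pairField_mul {v w : ℂ} (hv : w ≠ v) (hv' : w ≠ conj v) :
    ‖pairField v w‖ * (‖w - v‖ * ‖w - conj v‖) = 2 * ‖w - (v.re : ℂ)‖ := by
  have h1 : w - v ≠ 0 := sub_ne_zero.2 hv
  have h2 : w - conj v ≠ 0 := sub_ne_zero.2 hv'
  have e : pairField v w * ((w - v) * (w - conj v)) = 2 * (w - (v.re : ℂ)) := by
    unfold pairField
    field_simp
    have : (v.re : ℂ) * 2 = v + conj v := Complex.ext (by simp; ring) (by simp)
    linear_combination this
  have := congrArg (fun z : ℂ => ‖z‖) e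
  simpa [norm_mul] using this

/-- ★ (R2) **Energy drop at a nested successor under a bounded pair field** (complex form): `Im v > 0`, `Im w > 0`, `NestedStep v w`, `‖P_v(w)‖ ≤ κ`
⇒ `2(Im w)² ≤ κ² · Im v · (Im v + Im w) · ((Im v)² − (Im w)²)`. -/
theorem energyDrop_of_pairField_le {v w : ℂ} {κ : ℝ} (hv : 0 < v.im) (hw : 0 < w.im)
    (hnest : NestedStep v w) (hwv : w ≠ v) (hfield : ‖pairField v w‖ ≤ κ) :
    2 * w.im ^ 2 ≤ κ ^ 2 * v.im * (v.im + w.im) * (v.im ^ 2 - w.im ^ 2) := by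
  have hwv' : w ≠ conj v := by
    intro h; rw [h, Complex.conj_im] at hw; linarith
  have hmul := norm_pairField_mul hwv hwv'
  have hprod : 2 * ‖w - (v.re : ℂ)‖ ≤ κ * (‖w - v‖ * ‖w - conj v‖) := by
    rw [← hmul]; exact mul_le_mul_of_nonneg_right hfield (by positivity)
  have hsq : 4 * ((w.re - v.re) ^ 2 + w.im ^ 2) ≤
      κ ^ 2 * (((w.re - v.re) ^ 2 + (w.im - v.im) ^ 2) * ((w.re - v.re) ^ 2 + (w.im + v.im) ^ 2)) := by
    have h0 : 0 ≤ 2 * ‖w - (v.re : ℂ)‖ := by positivity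
    have := mul_self_le_mul_self h0 hprod
    rw [show 2 * ‖w - (v.re : ℂ)‖ * (2 * ‖w - (v.re : ℂ)‖) = 4 * ‖w - (v.re : ℂ)‖ ^ 2 by ring,
      show κ * (‖w - v‖ * ‖w - conj v‖) * (κ * (‖w - v‖ * ‖w - conj v‖)) = κ ^ 2 * (‖w - v‖ ^ 2 * ‖w - conj v‖ ^ 2) by ring,
      norm_sub_re_sq', norm_sub_sq', norm_sub_conj_sq'] at this
    exact this
  unfold NestedStep at hnest
  exact energyDrop_real (sq_nonneg _) hv hw hnest hsq

/-- ★★ (R2, tree form) **THE FAR-LEVEL DROP.** Legal frame, band state `v` of level `j`, an upper zero `w ≠ v` of `f^{(j+1)}` off `Z(f^{(j)})` that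
no zero of `f^{(j)}` other than `v, v̄` hosts (the FAR situation: nothing else within reach), and the EXTERNAL field at `w` bounded by `κ`
(`‖K_v(w)‖ ≤ κ`; the far law wants `κ = η/s`). Then `w` is a band state of level `j+1` (exact nesting, §3) AND
`2(Im w)² ≤ κ²·Im v·(Im v + Im w)·((Im v)² − (Im w)²)`; since `lowH (j+1) ≤ Im w`, the level's Jensen energy `lowH²` drops by
`≥ 2(Im w)²/(κ² Im v (Im v + Im w))` — `= (s/η)²` at hover, `≥ (1 − s/(4·Im v))²(s/η)²` on a charged (gently descending) level.
The bound `‖K_v(w)‖ ≤ η/s` at level `j` is the ONE analytic input of (R2) that `EngineHyps5` does not supply above height `hmax` or at `j ≥ 1`. -/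
theorem farDrop_levelj {η : ℝ} {f : ℂ → ℂ} {x₀ s hmax R Hs : ℝ} {B : ℕ}
    (hE : EngineHyps5 2 η f x₀ s hmax R Hs B) {j : ℕ} {v w : ℂ} (hv : StTrkDQ η f x₀ s hmax R Hs B j v)
    (hw0 : iteratedDeriv (j + 1) f w = 0) (hwim : 0 < w.im) (hgw : iteratedDeriv j f w ≠ 0) (hwv : w ≠ v)
    (hout : ∀ a : ℂ, iteratedDeriv j f a = 0 → a ≠ v → a ≠ conj v → |a.im| ≤ ‖w - (a.re : ℂ)‖)
    {κ : ℝ} (hK : ‖extField f j v w‖ ≤ κ) :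
    StTrkDQ η f x₀ s hmax R Hs B (j + 1) w ∧ 2 * w.im ^ 2 ≤ κ ^ 2 * v.im * (v.im + w.im) * (v.im ^ 2 - w.im ^ 2) := by
  have hn : NestedStep v w := nestedStep_of_unhosted hE hv hw0 hwim hgw hout
  refine ⟨stTrkDQ_succ_of_nested hE hv hw0 hwim hn, ?_⟩
  have hP : ‖pairField v w‖ ≤ κ := by rw [pairField_eq_neg_extField hw0, norm_neg]; exact hK
  exact energyDrop_of_pairField_le hv.2.2.1 hwim hn hwv hP

/-! ## §7 (RATE side, (R2)) the ONE open analytic input of the far law, typed as a socket -/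

/-- (R2-input, OPEN — the socket) **LEVEL-`j` FAR-FIELD BOUND.** On a legal frame, at a band state `v` of level `j` that is FAR (no zero of `f^{(j)}`
other than `v, v̄` in the near window `|Re z − Re v| < R/2` — the body of C4 g28's `FarLevelQ`), every NESTED upper zero `w` of `f^{(j+1)}` off
`Z(f^{(j)})` sees an external field `‖K_v(w)‖ ≤ η/s`. `EngineHyps5` supplies this only at level `0` and only for `|Im w| ≤ hmax` (`RemainderBox`);
at `j ≥ 1` or above `hmax` it is the analytic content of (R2) (heredity of the far field under differentiation + zero-count budgets). -/
def FarFieldBoundQ : Prop :=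
  ∀ (η : ℝ) (f : ℂ → ℂ) (x₀ s hmax R Hs : ℝ) (B : ℕ), EngineHyps5 2 η f x₀ s hmax R Hs B →
    ∀ (j : ℕ) (v w : ℂ), StTrkDQ η f x₀ s hmax R Hs B j v →
      (∀ z : ℂ, iteratedDeriv j f z = 0 → |z.re - v.re| < R / 2 → z = v ∨ z = conj v) →
      iteratedDeriv (j + 1) f w = 0 → 0 < w.im → iteratedDeriv j f w ≠ 0 → NestedStep v w →
      ‖extField f j v w‖ ≤ η / s

/-- ★ (R2 from the socket) `FarFieldBoundQ` ⇒ at a far band state `v` of level `j`, every upper zero `w ≠ v` of `f^{(j+1)}` off `Z(f^{(j)})` hosted by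
nothing but `v` is a level-`(j+1)` band state with `2(Im w)² ≤ (η/s)²·Im v·(Im v + Im w)·((Im v)² − (Im w)²)` — so `lowH² ` drops across the level by
`≥ (s/η)²·2y²/(b(b+y))` (`y = Im w`, `b = Im v`): `= (s/η)²` at hover, `≥ (1 − s/(4b))²(s/η)²` whenever `y ≥ b − s/4` (a charged level). -/
theorem farDrop_of_farFieldBoundQ (hF : FarFieldBoundQ) {η : ℝ} {f : ℂ → ℂ} {x₀ s hmax R Hs : ℝ} {B : ℕ}
    (hE : EngineHyps5 2 η f x₀ s hmax R Hs B) {j : ℕ} {v w : ℂ} (hv : StTrkDQ η f x₀ s hmax R Hs B j v)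
    (hfar : ∀ z : ℂ, iteratedDeriv j f z = 0 → |z.re - v.re| < R / 2 → z = v ∨ z = conj v)
    (hw0 : iteratedDeriv (j + 1) f w = 0) (hwim : 0 < w.im) (hgw : iteratedDeriv j f w ≠ 0) (hwv : w ≠ v)
    (hout : ∀ a : ℂ, iteratedDeriv j f a = 0 → a ≠ v → a ≠ conj v → |a.im| ≤ ‖w - (a.re : ℂ)‖) :
    StTrkDQ η f x₀ s hmax R Hs B (j + 1) w ∧ 2 * w.im ^ 2 ≤ (η / s) ^ 2 * v.im * (v.im + w.im) * (v.im ^ 2 - w.im ^ 2) :=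
  farDrop_levelj hE hv hw0 hwim hgw hwv hout
    (hF η f x₀ s hmax R Hs B hE j v w hv hfar hw0 hwim hgw (nestedStep_of_unhosted hE hv hw0 hwim hgw hout))


/-! ## §8 NEAR-MISS successors (WORDS-2; the (K) tool only — the global near-miss/slack SOCKETS of v5 are STRUCK, see the note at the end of this §): a NON-nested critical point near `v` is still a level-(j+1) band state when BAND_{j+1} has SLACK at `v`

Toy law of record (WORDS-2 + ADDENDUM, `g26/toy/theft_toy.py`): in dirty clusters the lowest (shortest) zero `v` is the natural victim of theft, but the
stolen critical point hugs `v`'s Jensen circle from outside (nearest upper critical point within `≈ 1.06–1.25·Im v` of `Re v`, height `≲ 1.2·Im v`).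
`StTrkDQ = StColQ'` asks BAND membership, not nesting — so such NEAR-MISS loot is a successor wherever the band has that much slack at `v`. -/

/-- NEAR-MISS loot of size `C` at the level-`j` zero `v`: an upper zero of `f^{(j+1)}` within `C·Im v` of `Re v` laterally and of height `≤ C·Im v`. -/
def NearMissAt (C : ℝ) (f : ℂ → ℂ) (j : ℕ) (v : ℂ) : Prop :=
  ∃ w : ℂ, iteratedDeriv (j + 1) f w = 0 ∧ 0 < w.im ∧ |w.re - v.re| ≤ C * v.im ∧ w.im ≤ C * v.im

/-- BAND_{j+1} SLACK of size `C` at `v`: the box `|Re w − Re v| ≤ C·Im v`, `0 < Im w ≤ C·Im v` fits inside the level-(j+1) band window. -/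
def SlackAt (C x₀ R Hs : ℝ) (j : ℕ) (v : ℂ) : Prop :=
  (max (|v.re - x₀| + C * v.im - R / 2) 0) ^ 2 + ((j : ℝ) + 1) * (C * v.im) ^ 2 ≤ ((j : ℝ) + 1) * Hs ^ 2 ∧ C * v.im ≤ Hs

/-- ★ (K) a near-miss critical point at a band state with slack IS a level-(j+1) band state. -/
theorem stTrkDQ_succ_of_nearMiss {η : ℝ} {f : ℂ → ℂ} {x₀ s hmax R Hs : ℝ} {B j : ℕ} {v w : ℂ} {C : ℝ}
    (hE : EngineHyps5 2 η f x₀ s hmax R Hs B) (hv : StTrkDQ η f x₀ s hmax R Hs B j v)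
    (hw0 : iteratedDeriv (j + 1) f w = 0) (hwim : 0 < w.im) (hre : |w.re - v.re| ≤ C * v.im) (him : w.im ≤ C * v.im)
    (hsl : SlackAt C x₀ R Hs j v) : StTrkDQ η f x₀ s hmax R Hs B (j + 1) w := by
  have hfnz : iteratedDeriv (j + 1) f ≠ 0 := iteratedDeriv_succ_ne_zero_of_zero hE.1 j hv.1 hv.2.1
  refine ⟨hfnz, hw0, hwim, ?_, le_trans him hsl.2⟩
  have h1 : |w.re - x₀| ≤ |v.re - x₀| + C * v.im := by
    calc |w.re - x₀| = |(w.re - v.re) + (v.re - x₀)| := by congr 1; ring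
      _ ≤ |w.re - v.re| + |v.re - x₀| := abs_add_le _ _
      _ ≤ |v.re - x₀| + C * v.im := by linarith
  have hm0 : 0 ≤ max (|w.re - x₀| - R / 2) 0 := le_max_right _ _
  have hm : max (|w.re - x₀| - R / 2) 0 ≤ max (|v.re - x₀| + C * v.im - R / 2) 0 := max_le_max (by linarith) le_rfl
  have hsq : (max (|w.re - x₀| - R / 2) 0) ^ 2 ≤ (max (|v.re - x₀| + C * v.im - R / 2) 0) ^ 2 := pow_le_pow_left₀ hm0 hm 2
  have hw2 : w.im ^ 2 ≤ (C * v.im) ^ 2 := pow_le_pow_left₀ hwim.le him 2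
  have hj : (0 : ℝ) ≤ (j : ℝ) + 1 := by positivity
  have hband := hsl.1
  push_cast
  nlinarith [mul_le_mul_of_nonneg_left hw2 hj]

/-- (K) slack in the COLUMN: if the near-miss box stays inside `|Re − x₀| ≤ R/2` and below `Hs`, BAND_{j+1} has slack of size `C` at `v` for every `j`. -/
theorem slackAt_of_column {C x₀ R Hs : ℝ} (j : ℕ) {v : ℂ} (hcol : |v.re - x₀| + C * v.im ≤ R / 2) (hC0 : 0 ≤ C * v.im)
    (hHs : C * v.im ≤ Hs) : SlackAt C x₀ R Hs j v := by
  refine ⟨?_, hHs⟩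
  have hmax : max (|v.re - x₀| + C * v.im - R / 2) 0 = 0 := max_eq_right (by linarith)
  rw [hmax]
  have hj : (0 : ℝ) ≤ (j : ℝ) + 1 := by positivity
  have h2 : (C * v.im) ^ 2 ≤ Hs ^ 2 := pow_le_pow_left₀ hC0 hHs 2
  nlinarith [mul_le_mul_of_nonneg_left h2 hj]

/-- (K) slack ON/NEAR the BAND_j boundary in the WING: if `v` is a level-`j` band state with lateral excess `e = |Re v − x₀| − R/2 ≥ 0` and the near-miss
box satisfies the explicit inequality `(e + C·Im v)² + (j+1)(C·Im v)² ≤ (j+1)Hs²` (the slack factor of WORDS-2 (C1)), then `SlackAt C` holds. -/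
theorem slackAt_of_wing {C x₀ R Hs : ℝ} (j : ℕ) {v : ℂ} (he : R / 2 ≤ |v.re - x₀|) (hC0 : 0 ≤ C * v.im) (hHs : C * v.im ≤ Hs)
    (hineq : (|v.re - x₀| - R / 2 + C * v.im) ^ 2 + ((j : ℝ) + 1) * (C * v.im) ^ 2 ≤ ((j : ℝ) + 1) * Hs ^ 2) : SlackAt C x₀ R Hs j v := by
  refine ⟨?_, hHs⟩
  have hmax : max (|v.re - x₀| + C * v.im - R / 2) 0 = |v.re - x₀| - R / 2 + C * v.im := by
    rw [max_eq_left (by linarith)]; ring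
  rw [hmax]; exact hineq

/- STRUCK (critic RESULT-19 09:56:19Z, LEGAL column-corner frames `g21/own/nse/corner{1,2}.json`): the pair of global sockets
`NearMissLawQ C ∧ SlackLawQ C` (v5 2cfe615d ll. 557–576, with `antiEscape_of_nearMiss` / `restSuccBotQ_of_nearMiss`) is FALSE for every `C` on legal
frames — at the corner the square near-miss box pokes out of the column (C_need 0.947 > C_max 0.757) while v's actual loot is NESTED (ρ = 0.077, a successor
by #1032). They are NOT landed. What survives is the (K) tool `stTrkDQ_succ_of_nearMiss` + the slack lemmas above, to be used pointwise next to
`stTrkDQ_succ_of_nested`; the live residual doors remain `AntiTheft` (§4) and `RhW08.IsoWin.AntiEscapeCoreB`. -/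



/-! ## §9 MULTI-SCALE DIMPLE (WORDS-3): `¬ReadyR2` blocks the dimple at EVERY scale `ρ ≤ Hs` around a band state

The tree's dimple lemma (`RhIdea3.G35.Landing.readyR2_of_dimple`, general interval) specialised to the symmetric interval `[Re v − ρ, Re v + ρ]` of ANY
radius `0 < ρ ≤ Hs` around a level-`k` band state `v` (range automatic by `abs_re_sub_le_of_stTrkDQ` + `band_radius_lt_range'`, exactly as in
`readyR2_of_dimple_state`, which is the case `ρ = Im v`). Reading (the STRONG-FIELD ALTERNATIVE): in the residual of STUB 1 (`¬ReadyR2` at level k), for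
every tooth-free scale `ρ ∈ (0, Hs]` the signs of `F_{k+1}·F_k` at `Re v ∓ ρ` are NOT the dimple signs `(−, +)`: the real log-derivative `F_{k+1}/F_k` is
`≥ 0` at `Re v − ρ` or `≤ 0` at `Re v + ρ` — the ambient field beats the pair field `∓(2ρ·…)` at one end, AT EVERY SCALE up to the first tooth. -/

/-- ★ (K) multi-scale dimple ⇒ Ready′. -/
theorem readyR2_of_dimple_scale {η : ℝ} {f : ℂ → ℂ} {x₀ s hmax R Hs : ℝ} {B : ℕ} (hE : EngineHyps5 2 η f x₀ s hmax R Hs B)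
    (k : ℕ) (u : ℂ) {v : ℂ} (hv : StTrkDQ η f x₀ s hmax R Hs B k v) {ρ : ℝ} (hρ0 : 0 < ρ) (hρ : ρ ≤ Hs)
    (hnz : ∀ x ∈ Icc (v.re - ρ) (v.re + ρ), iteratedDeriv k f (x : ℂ) ≠ 0)
    (hα : (iteratedDeriv (k + 1) f ((v.re - ρ : ℝ) : ℂ)).re * (iteratedDeriv k f ((v.re - ρ : ℝ) : ℂ)).re < 0)
    (hβ : 0 < (iteratedDeriv (k + 1) f ((v.re + ρ : ℝ) : ℂ)).re * (iteratedDeriv k f ((v.re + ρ : ℝ) : ℂ)).re) :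
    ReadyR2 η f x₀ s hmax R Hs B k u := by
  obtain ⟨hf, hreal, _, hs, hCs, hChm, h3, hHs, _, hCHs, _⟩ := hE
  have hR0 : 0 < R := by linarith
  have h1 : |v.re - x₀| ≤ R / 2 + Real.sqrt k * Hs := abs_re_sub_le_of_stTrkDQ hHs hv
  have h2 : R / 2 + Real.sqrt k * Hs + Hs < ((k : ℝ) + 3) * R / 2 := band_radius_lt_range' hHs hCHs hR0 k
  rw [abs_le] at h1
  have hrα : |(v.re - ρ) - x₀| < ((k : ℝ) + 3) * R / 2 := by
    rw [abs_lt]; constructor <;> linarith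
  have hrβ : |(v.re + ρ) - x₀| < ((k : ℝ) + 3) * R / 2 := by
    rw [abs_lt]; constructor <;> linarith
  exact RhIdea3.G35.Landing.readyR2_of_dimple hf η x₀ s hmax R Hs B k u (Literature.Analysis.Complex.im_iteratedDeriv_ofReal hf hreal k)
    (by linarith) hrα hrβ hnz hα hβ

/-- ★ (K) the STRONG-FIELD ALTERNATIVE at scale `ρ`: at a non-Ready′ level, around any band state `v` and at every tooth-free scale `0 < ρ ≤ Hs`,
`F_{k+1}·F_k (Re v − ρ) ≥ 0` or `F_{k+1}·F_k (Re v + ρ) ≤ 0`. -/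
theorem blocked_at_scale {η : ℝ} {f : ℂ → ℂ} {x₀ s hmax R Hs : ℝ} {B : ℕ} (hE : EngineHyps5 2 η f x₀ s hmax R Hs B)
    (k : ℕ) (u : ℂ) {v : ℂ} (hv : StTrkDQ η f x₀ s hmax R Hs B k v) (hnr : ¬ ReadyR2 η f x₀ s hmax R Hs B k u)
    {ρ : ℝ} (hρ0 : 0 < ρ) (hρ : ρ ≤ Hs) (hnz : ∀ x ∈ Icc (v.re - ρ) (v.re + ρ), iteratedDeriv k f (x : ℂ) ≠ 0) :
    0 ≤ (iteratedDeriv (k + 1) f ((v.re - ρ : ℝ) : ℂ)).re * (iteratedDeriv k f ((v.re - ρ : ℝ) : ℂ)).re ∨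
      (iteratedDeriv (k + 1) f ((v.re + ρ : ℝ) : ℂ)).re * (iteratedDeriv k f ((v.re + ρ : ℝ) : ℂ)).re ≤ 0 := by
  rcases lt_or_ge ((iteratedDeriv (k + 1) f ((v.re - ρ : ℝ) : ℂ)).re * (iteratedDeriv k f ((v.re - ρ : ℝ) : ℂ)).re) 0 with hα | hα
  · rcases lt_or_ge 0 ((iteratedDeriv (k + 1) f ((v.re + ρ : ℝ) : ℂ)).re * (iteratedDeriv k f ((v.re + ρ : ℝ) : ℂ)).re) with hβ | hβ
    · exact absurd (readyR2_of_dimple_scale hE k u hv hρ0 hρ hnz hα hβ) hnr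
    · exact Or.inr hβ
  · exact Or.inl hα

end RhW08.SuccTheft
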